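import Mathlib
import HarnessLib
import Literature.NumberTheory.Transcendental.BugeaudLaurentPadicTwoLogarithms

/-!
# The first open case of `abc`, shape B (`p^l + q^m = 2^n`): the KNOWN side, typed

`Summits/ABC/ABC/Theorems/SoloBlindShapeBKnown.lean`; namespace `Summit.ABC.ABC.Theorems`
(solo seat `solo-ABC-blind`, wall coordinate C1‴/C1⁗(1) of the seat's report).

Among coprime `a + b = c` with `ω(abc) = 3` the supports are `{2, p, q}` (`p ≠ q` odd primes), and the
pure-power shape with `c` a power of `2` is `p^l + q^m = 2^n` ("shape B").  On it the `abc`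
conjecture says `n log 2 ≤ (1 + ε) log(2pq) + O_ε(1)` — the SUM of the heights `log p`, `log q`
(`abc_iff_logLinearOmega`, `SoloBlindOmegaFree.lean`, read at `ω = 3`, `rad(abc) = 2pq`).  What is
KNOWN is a bound by their PRODUCT: `n = ord₂(p^l + q^m) = ord₂((∓p)^l (±q)^{-m} − 1)` is the `2`-adic
valuation of a two-term expression in the multiplicatively independent `2`-adic units `±p`, `±q`, and
the Bugeaud–Laurent estimate for two `p`-adic logarithms (named fact
`Literature.NumberTheory.Transcendental.bugeaudLaurent1996_rat`, at the prime `2`, `g = 1`,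
`H₁ = log p`, `H₂ = log q`) gives `n ≤ 48/(log 2)⁴ · log p · log q · (max{log b″ + log log 2 + 0.4, 10})²`
with the NORMALISED exponent `b″ = l/log q + m/log p < 2 log 2 · n/(log p · log q)`.  Because `b″` is
(up to the factor `log p log q`) the unknown `n` itself, the inequality inverts to an ABSOLUTE multiple
of `log p · log q`:

* `shapeB_exponent_le` : `p^l + q^m = 2^n`, `p ≠ q` odd primes, `l, m ≥ 1` ⟹ `n ≤ 50000 · log p · log q`;
* `shapeB_log_c_le`    : the same for `log c = n log 2`.

So on this family the distance between theorem and conjecture is exactly "product of the two heights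
versus their sum", with no `log log` or `N(℘)` loss — the seat's constraint C1″(ii) in its cleanest
instance.  The constant is crude (`50000`; the printed data give `≈ 2.3·10⁴`): only the shape
`X ≤ C (log X + c)² ⟹ X ≤ X₀` of the inversion (`le_of_le_mul_max_log_sq`) matters.

Trust base: the named fact `bugeaudLaurent1996_rat` (Bugeaud–Laurent, J. Number Theory 61 (1996),
as printed in Luca 2019, Thm 11.5), taken as a hypothesis; everything else is proved.
-/


noncomputable section

namespace Summit.ABC.ABC.Theorems

open Real Literature.NumberTheory.Transcendental

/-- On `p^l + q^m = 2^n` with `p, q` odd and `l ≥ 1`, the exponents `l, m` are not both even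
(odd squares are `1 mod 4`, so the sum would be `2 mod 4`, forcing `n = 1`). [folklore] -/
theorem shapeB_not_both_even {p q l m n : ℕ} (hp : Odd p) (hq : Odd q) (hp3 : 3 ≤ p)
    (hl : 0 < l) (h : p ^ l + q ^ m = 2 ^ n) : Odd l ∨ Odd m := by
  by_contra hcon
  push Not at hcon
  obtain ⟨hle, hme⟩ := hcon
  rw [Nat.not_odd_iff_even] at hle hme
  obtain ⟨i, hi⟩ := hle
  obtain ⟨j, hj⟩ := hme
  have h1 : p ^ l % 4 = 1 := by
    rw [hi, ← two_mul, pow_mul]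
    obtain ⟨r, hr⟩ := hp
    have : p ^ 2 % 4 = 1 := by
      rw [hr]; ring_nf
      omega
    rw [Nat.pow_mod, this]; simp
  have h2 : q ^ m % 4 = 1 := by
    rw [hj, ← two_mul, pow_mul]
    obtain ⟨r, hr⟩ := hq
    have : q ^ 2 % 4 = 1 := by
      rw [hr]; ring_nf
      omega
    rw [Nat.pow_mod, this]; simp
  have h3 : 2 ^ n % 4 = 2 := by omega
  have hn : n = 1 := by
    rcases Nat.lt_or_ge n 2 with hn | hn
    · interval_cases n <;> simp_all
    · obtain ⟨k, rfl⟩ := Nat.exists_eq_add_of_le hn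
      rw [pow_add] at h3
      omega
  subst hn
  have : 3 ≤ p ^ l := le_trans hp3 (Nat.le_self_pow hl.ne' p)
  have : 1 ≤ q ^ m := Nat.one_le_pow _ _ (by rcases hq with ⟨r, hr⟩; omega)
  omega

/-- Numerical constant: `48/(log 2)⁴ ≤ 210`. [folklore] -/
theorem fortyeight_div_log_two_pow_four_le : 48 / Real.log 2 ^ 4 ≤ 210 := by
  have h2 : (0.6931471803 : ℝ) < Real.log 2 := Real.log_two_gt_d9
  have hpos : 0 < Real.log 2 ^ 4 := by positivity
  rw [div_le_iff₀ hpos]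
  have : (0.6931471803 : ℝ) ^ 4 ≤ Real.log 2 ^ 4 := by
    exact pow_le_pow_left₀ (by norm_num) h2.le 4
  nlinarith

/-- Numerical constant: `log 50000 < 11`. [folklore] -/
theorem log_fifty_thousand_lt : Real.log 50000 < 11 := by
  have he : (2.7182818283 : ℝ) < Real.exp 1 := Real.exp_one_gt_d9
  have h11 : (50000 : ℝ) < Real.exp 11 := by
    have : Real.exp 11 = Real.exp 1 ^ 11 := by
      rw [Real.exp_one_pow]; norm_num
    rw [this]
    calc (50000 : ℝ) < (2.7182818283 : ℝ) ^ 11 := by norm_num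
      _ ≤ Real.exp 1 ^ 11 := by
        exact pow_le_pow_left₀ (by norm_num) he.le 11
  calc Real.log 50000 < Real.log (Real.exp 11) :=
        Real.log_lt_log (by norm_num) h11
    _ = 11 := Real.log_exp 11

/-- The real-variable inversion: `X ≤ 210 · (max(log X + 0.48, 10))²` with `X > 0` forces
`X ≤ 50000`. [folklore] -/
theorem le_of_le_mul_max_log_sq {X : ℝ} (hX : 0 < X)
    (h : X ≤ 210 * max (Real.log X + 0.48) 10 ^ 2) : X ≤ 50000 := by
  by_contra hcon
  push Not at hcon
  -- the `max` is the logarithmic branch or the constant branch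
  rcases le_or_gt (Real.log X + 0.48) 10 with hA | hB
  · rw [max_eq_right hA] at h
    linarith
  · rw [max_eq_left hB.le] at h
    -- write X = 50000 u, u > 1, s = √u
    set u : ℝ := X / 50000 with hu
    have hu1 : 1 < u := by rw [hu, lt_div_iff₀ (by norm_num : (0:ℝ) < 50000)]; linarith
    have hu0 : 0 < u := by linarith
    have hXu : X = 50000 * u := by rw [hu]; field_simp
    set s : ℝ := Real.sqrt u with hs
    have hs0 : 0 ≤ s := Real.sqrt_nonneg u
    have hsu : s ^ 2 = u := Real.sq_sqrt hu0.le
    have hs1 : 1 < s := by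
      rw [hs]
      calc (1 : ℝ) = Real.sqrt 1 := Real.sqrt_one.symm
        _ < Real.sqrt u := Real.sqrt_lt_sqrt (by norm_num) hu1
    have hlogu : Real.log u ≤ 2 * (s - 1) := by
      have h1 : Real.log s ≤ s - 1 := Real.log_le_sub_one_of_pos (by linarith)
      have h2 : Real.log u = 2 * Real.log s := by
        rw [← hsu, Real.log_pow]; norm_num
      linarith
    have hlogX : Real.log X = Real.log 50000 + Real.log u := by
      rw [hXu, Real.log_mul (by norm_num) hu0.ne']
    have hL : Real.log X + 0.48 ≤ 11.48 * s := by
      have := log_fifty_thousand_lt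
      nlinarith
    have hLpos : 0 ≤ Real.log X + 0.48 := by linarith
    have hsq : (Real.log X + 0.48) ^ 2 ≤ (11.48 * s) ^ 2 := by
      apply pow_le_pow_left₀ hLpos hL
    have : X ≤ 210 * (11.48 * s) ^ 2 := le_trans h (by nlinarith)
    rw [hXu] at this
    nlinarith

/-- **Shape B, known side (case `l` odd).**  From the Bugeaud–Laurent two-logarithm estimate at the
prime `2`: if `p ≠ q` are odd primes, `l` is odd, `m ≥ 1` and `p^l + q^m = 2^n`, then
`n ≤ 50000 · log p · log q`. [folklore] -/
theorem shapeB_exponent_le_of_odd (hBL : bugeaudLaurent1996_rat) {p q l m n : ℕ}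
    (hp : p.Prime) (hq : q.Prime) (hp2 : p ≠ 2) (hq2 : q ≠ 2) (hpq : p ≠ q)
    (hl : Odd l) (hm : 0 < m) (h : p ^ l + q ^ m = 2 ^ n) :
    (n : ℝ) ≤ 50000 * Real.log p * Real.log q := by
  have hp3 : 3 ≤ p := by have := hp.two_le; omega
  have hq3 : 3 ≤ q := by have := hq.two_le; omega
  have hpodd : Odd p := hp.odd_of_ne_two hp2
  have hqodd : Odd q := hq.odd_of_ne_two hq2
  have hl0 : 0 < l := hl.pos
  -- sizes: p^l < 2^n, q^m < 2^n, n ≥ 1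
  have hpl : p ^ l < 2 ^ n := by
    have : 1 ≤ q ^ m := Nat.one_le_pow _ _ hq.pos
    omega
  have hqm : q ^ m < 2 ^ n := by
    have : 1 ≤ p ^ l := Nat.one_le_pow _ _ hp.pos
    omega
  have hn0 : 0 < n := by
    rcases Nat.eq_zero_or_pos n with hn | hn
    · subst hn
      have : 3 ≤ p ^ l := le_trans hp3 (Nat.le_self_pow hl0.ne' p)
      simp at h; omega
    · exact hn
  -- real logs
  have hP : 1 < Real.log p := by
    have : Real.log (Real.exp 1) < Real.log p := by
      apply Real.log_lt_log (Real.exp_pos 1)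
      have he : Real.exp 1 < 2.7182818286 := Real.exp_one_lt_d9
      have : (3 : ℝ) ≤ p := by exact_mod_cast hp3
      linarith
    rwa [Real.log_exp] at this
  have hQ : 1 < Real.log q := by
    have : Real.log (Real.exp 1) < Real.log q := by
      apply Real.log_lt_log (Real.exp_pos 1)
      have he : Real.exp 1 < 2.7182818286 := Real.exp_one_lt_d9
      have : (3 : ℝ) ≤ q := by exact_mod_cast hq3
      linarith
    rwa [Real.log_exp] at this
  have hP0 : 0 < Real.log p := by linarith
  have hQ0 : 0 < Real.log q := by linarith
  have hlog2 : 0 < Real.log 2 := Real.log_pos (by norm_num)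
  have hlog2' : Real.log 2 < 1 := by
    have := Real.log_two_lt_d9; linarith
  -- l log p < n log 2 and m log q < n log 2
  have hlP : (l : ℝ) * Real.log p < n * Real.log 2 := by
    have h1 : ((p : ℝ) ^ l) < (2 : ℝ) ^ n := by exact_mod_cast hpl
    have h2 := Real.log_lt_log (by positivity) h1
    rwa [Real.log_pow, Real.log_pow] at h2
  have hmQ : (m : ℝ) * Real.log q < n * Real.log 2 := by
    have h1 : ((q : ℝ) ^ m) < (2 : ℝ) ^ n := by exact_mod_cast hqm
    have h2 := Real.log_lt_log (by positivity) h1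
    rwa [Real.log_pow, Real.log_pow] at h2
  -- apply the fact at the prime 2 with a₁ = -p, a₂ = q, b₁ = l, b₂ = -m
  haveI := Fact.mk hp
  have hind : ∀ x y : ℤ, ((-(p : ℤ) : ℤ) : ℚ) ^ x * ((q : ℤ) : ℚ) ^ y = 1 → x = 0 ∧ y = 0 := by
    intro x y hxy
    push_cast at hxy
    have hp0 : (-(p : ℚ)) ≠ 0 := by
      have : (p : ℚ) ≠ 0 := by exact_mod_cast hp.ne_zero
      exact neg_ne_zero.mpr this
    have hq0 : (q : ℚ) ≠ 0 := by exact_mod_cast hq.ne_zero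
    have hv := congrArg (padicValRat p) hxy
    rw [padicValRat.mul (zpow_ne_zero x hp0) (zpow_ne_zero y hq0), padicValRat.zpow,
      padicValRat.zpow, padicValRat.neg, padicValRat.self hp.one_lt, padicValRat.one] at hv
    have hvq : padicValRat p (q : ℚ) = 0 := by
      rw [padicValRat.of_nat]; haveI := Fact.mk hq; exact_mod_cast padicValNat_primes hpq
    rw [hvq] at hv
    have hx : x = 0 := by simpa using hv
    subst hx
    refine ⟨rfl, ?_⟩
    simp only [zpow_zero, one_mul] at hxy
    have hq1 : (1 : ℚ) < q := by exact_mod_cast hq.one_lt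
    have := (zpow_right_inj₀ (by linarith) hq1.ne') |>.mp (hxy.trans (zpow_zero (q : ℚ)).symm)
    exact this
  have hpoddZ : Odd (-(p : ℤ)) := (by exact_mod_cast hpodd : Odd (p : ℤ)).neg
  have hqoddZ : Odd (q : ℤ) := by exact_mod_cast hqodd
  have hlZ : (l : ℤ) ≠ 0 := by exact_mod_cast hl0.ne'
  have hmZ : (-(m : ℤ)) ≠ 0 := by
    have : (m : ℤ) ≠ 0 := by exact_mod_cast hm.ne'
    exact neg_ne_zero.mpr this
  have hH₁ : max (Real.log |((-(p : ℤ) : ℤ) : ℝ)|) (Real.log 2) ≤ Real.log p := by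
    push_cast
    rw [abs_neg, Nat.abs_cast]
    apply max_le le_rfl
    exact Real.log_le_log (by norm_num) (by exact_mod_cast hp.two_le)
  have hH₂ : max (Real.log |(((q : ℤ)) : ℝ)|) (Real.log 2) ≤ Real.log q := by
    push_cast
    rw [Nat.abs_cast]
    apply max_le le_rfl
    exact Real.log_le_log (by norm_num) (by exact_mod_cast hq.two_le)
  have key := hBL.two_odd hpoddZ hqoddZ hind hlZ hmZ hH₁ hH₂
  -- the left-hand side is `n`
  have hLHS : padicValRat 2 (((-(p : ℤ) : ℤ) : ℚ) ^ (l : ℤ) * ((q : ℤ) : ℚ) ^ (-(m : ℤ)) - 1) = n := by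
    push_cast
    have hq0 : (q : ℚ) ≠ 0 := by exact_mod_cast hq.ne_zero
    have hqm0 : (q : ℚ) ^ m ≠ 0 := pow_ne_zero _ hq0
    have hexpr : (-(p : ℚ)) ^ (l : ℤ) * (q : ℚ) ^ (-(m : ℤ)) - 1
        = -((2 : ℚ) ^ n) / (q : ℚ) ^ m := by
      rw [zpow_natCast, zpow_neg, zpow_natCast, hl.neg_pow]
      have hcast : ((p : ℚ) ^ l + (q : ℚ) ^ m) = (2 : ℚ) ^ n := by exact_mod_cast h
      field_simp
      linear_combination (-1 : ℚ) * hcast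
    rw [hexpr, neg_div, padicValRat.neg,
      padicValRat.div (pow_ne_zero _ (by norm_num)) hqm0, padicValRat.pow, padicValRat.pow]
    haveI : Fact (Nat.Prime 2) := ⟨Nat.prime_two⟩
    have h2 : padicValRat 2 (2 : ℚ) = 1 := by
      have := padicValRat.self (p := 2) (by norm_num)
      exact_mod_cast this
    have hq2' : padicValRat 2 (q : ℚ) = 0 := by
      rw [padicValRat.of_nat]
      haveI := Fact.mk hq
      exact_mod_cast padicValNat_primes (Ne.symm hq2)
    rw [h2, hq2']
    ring
  rw [hLHS] at key
  push_cast at key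
  -- simplify the right-hand side data
  have hmax10 : max (10 * Real.log 2) 10 = (10 : ℝ) := by
    apply max_eq_right; linarith
  rw [hmax10] at key
  -- the normalised exponent b'' < 2 log 2 · X with X = n/(log p log q)
  set X : ℝ := (n : ℝ) / (Real.log p * Real.log q) with hXdef
  have hPQ : 0 < Real.log p * Real.log q := mul_pos hP0 hQ0
  have hX0 : 0 < X := by rw [hXdef]; positivity
  have hnX : (n : ℝ) = X * (Real.log p * Real.log q) := by
    rw [hXdef]; field_simp
  have hb'' : |(l : ℝ)| / Real.log q + |(-(m : ℝ))| / Real.log p < 2 * Real.log 2 * X := by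
    rw [abs_neg, Nat.abs_cast, Nat.abs_cast]
    have h1 : (l : ℝ) / Real.log q < (n * Real.log 2) / (Real.log p * Real.log q) := by
      rw [div_lt_div_iff₀ hQ0 hPQ]
      nlinarith
    have h2 : (m : ℝ) / Real.log p < (n * Real.log 2) / (Real.log p * Real.log q) := by
      rw [div_lt_div_iff₀ hP0 hPQ]
      nlinarith
    have h3 : (n * Real.log 2) / (Real.log p * Real.log q) = Real.log 2 * X := by
      rw [hXdef]; ring
    linarith
  have hb''pos : 0 < |(l : ℝ)| / Real.log q + |(-(m : ℝ))| / Real.log p := by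
    rw [abs_neg, Nat.abs_cast, Nat.abs_cast]
    have : (0 : ℝ) < l := by exact_mod_cast hl0
    positivity
  -- log b'' + log log 2 + 0.4 ≤ log X + 0.48
  have hA : Real.log (|(l : ℝ)| / Real.log q + |(-(m : ℝ))| / Real.log p) + Real.log (Real.log 2) + 0.4
      ≤ Real.log X + 0.48 := by
    have h1 : Real.log (|(l : ℝ)| / Real.log q + |(-(m : ℝ))| / Real.log p)
        ≤ Real.log (2 * Real.log 2 * X) := Real.log_le_log hb''pos hb''.le
    have h2 : Real.log (2 * Real.log 2 * X) = Real.log (2 * Real.log 2) + Real.log X := by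
      rw [Real.log_mul (by positivity) hX0.ne']
    have h3 : Real.log (2 * Real.log 2) ≤ 2 * Real.log 2 - 1 :=
      Real.log_le_sub_one_of_pos (by positivity)
    have h4 : Real.log (Real.log 2) ≤ Real.log 2 - 1 := Real.log_le_sub_one_of_pos hlog2
    have h5 : Real.log 2 < 0.6931471808 := Real.log_two_lt_d9
    linarith
  have hM : max (Real.log (|(l : ℝ)| / Real.log q + |(-(m : ℝ))| / Real.log p)
        + Real.log (Real.log 2) + 0.4) 10 ≤ max (Real.log X + 0.48) 10 :=
    max_le_max hA le_rfl
  have hM0 : 0 ≤ max (Real.log (|(l : ℝ)| / Real.log q + |(-(m : ℝ))| / Real.log p)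
        + Real.log (Real.log 2) + 0.4) 10 := le_trans (by norm_num) (le_max_right _ _)
  have hMsq := pow_le_pow_left₀ hM0 hM 2
  have hC := fortyeight_div_log_two_pow_four_le
  -- assemble: n ≤ 210 · log p log q · (max (log X + 0.48) 10)²
  have hmain : (n : ℝ) ≤ 210 * (Real.log p * Real.log q) * max (Real.log X + 0.48) 10 ^ 2 := by
    have hrhs : 48 * Real.log p * Real.log q / Real.log 2 ^ 4 =
        (48 / Real.log 2 ^ 4) * (Real.log p * Real.log q) := by ring
    rw [hrhs] at key
    have hnonneg : 0 ≤ max (Real.log X + 0.48) 10 ^ 2 := by positivity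
    calc (n : ℝ) ≤ (48 / Real.log 2 ^ 4) * (Real.log p * Real.log q) *
          max (Real.log (|(l : ℝ)| / Real.log q + |(-(m : ℝ))| / Real.log p)
            + Real.log (Real.log 2) + 0.4) 10 ^ 2 := key
      _ ≤ (48 / Real.log 2 ^ 4) * (Real.log p * Real.log q) * max (Real.log X + 0.48) 10 ^ 2 := by
          apply mul_le_mul_of_nonneg_left hMsq; positivity
      _ ≤ 210 * (Real.log p * Real.log q) * max (Real.log X + 0.48) 10 ^ 2 := by
          apply mul_le_mul_of_nonneg_right _ hnonneg
          apply mul_le_mul_of_nonneg_right hC hPQ.le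
  have hXle : X ≤ 210 * max (Real.log X + 0.48) 10 ^ 2 := by
    rw [hnX] at hmain
    have := div_le_div_of_nonneg_right hmain hPQ.le
    have e1 : X * (Real.log p * Real.log q) / (Real.log p * Real.log q) = X := by
      field_simp
    have e2 : 210 * (Real.log p * Real.log q) * max (Real.log X + 0.48) 10 ^ 2 /
        (Real.log p * Real.log q) = 210 * max (Real.log X + 0.48) 10 ^ 2 := by
      field_simp
    rw [e1, e2] at this
    exact this
  have hX50000 := le_of_le_mul_max_log_sq hX0 hXle
  rw [hnX]
  nlinarith

/-- **Shape B, known side** (the first open case of `abc`, `ω = 3`, bracketed from above).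
If `p ≠ q` are odd primes, `l, m ≥ 1` and `p^l + q^m = 2^n`, then, granting the Bugeaud–Laurent
two-logarithm `2`-adic estimate (named fact `bugeaudLaurent1996_rat`),
`n ≤ 50000 · log p · log q` — a bound by the PRODUCT of the two heights, uniformly in the exponents
(no `log log` term, because the normalised exponent `b'' ≍ n/(log p log q)` is itself the unknown).
The `abc` conjecture on this family reads `n log 2 ≤ (1+ε) log(2pq) + O_ε(1)`
(`abc_iff_logLinearOmega` in `SoloBlindOmegaFree.lean` with `ω(abc) = 3`, `rad = 2pq`), i.e. the
SUM of the heights: the gap between the two is the whole content of `abc` on `p^l + q^m = 2^n`.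
The constant `50000` is crude (the printed data give about `2.3·10⁴`). [folklore] -/
theorem shapeB_exponent_le (hBL : bugeaudLaurent1996_rat) {p q l m n : ℕ}
    (hp : p.Prime) (hq : q.Prime) (hp2 : p ≠ 2) (hq2 : q ≠ 2) (hpq : p ≠ q)
    (hl : 0 < l) (hm : 0 < m) (h : p ^ l + q ^ m = 2 ^ n) :
    (n : ℝ) ≤ 50000 * Real.log p * Real.log q := by
  have hp3 : 3 ≤ p := by have := hp.two_le; omega
  rcases shapeB_not_both_even (hp.odd_of_ne_two hp2) (hq.odd_of_ne_two hq2) hp3 hl h with hlo | hmo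
  · exact shapeB_exponent_le_of_odd hBL hp hq hp2 hq2 hpq hlo hm h
  · have h' : q ^ m + p ^ l = 2 ^ n := by omega
    have := shapeB_exponent_le_of_odd hBL hq hp hq2 hp2 (Ne.symm hpq) hmo hl h'
    linarith [this]

/-- The same bound for `c = 2^n` itself: `log c = n log 2 ≤ 50000 log 2 · log p · log q`.
[folklore] -/
theorem shapeB_log_c_le (hBL : bugeaudLaurent1996_rat) {p q l m n : ℕ}
    (hp : p.Prime) (hq : q.Prime) (hp2 : p ≠ 2) (hq2 : q ≠ 2) (hpq : p ≠ q)
    (hl : 0 < l) (hm : 0 < m) (h : p ^ l + q ^ m = 2 ^ n) :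
    Real.log ((2 : ℝ) ^ n) ≤ 50000 * Real.log 2 * Real.log p * Real.log q := by
  rw [Real.log_pow]
  have := shapeB_exponent_le hBL hp hq hp2 hq2 hpq hl hm h
  have hlog2 : 0 < Real.log 2 := Real.log_pos (by norm_num)
  nlinarith

end Summit.ABC.ABC.Theorems

end
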